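import Summits.Ventures.Crystal3D.Theorems.StickyWulffConstantGenericWallFloorStarFarSound
import HarnessLib

/-!
# Kernel discharge of `StarPairFar`, part 5: soundness of the searches and of a task; the top boxes cover the charts

HONEST FRAMING. Venture `Summits/Ventures/Crystal3D` (cell `crystal3d-full`), helper `--supports` the crux
`GenericWallFloor` (stmt-Ventures-19480) of `route-Ventures-StickyWulffConstant`, line `WallLedgerG`.  Rung credit only;
F-C1 not moved.  From the test soundness of part 4: `ySearch_sound` (induction on the bisection fuel; the threaded budget
is irrelevant to soundness), `yLevel_sound` (the root Y-box contains the sphere), `qSearch_sound` (induction on fuel;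
`Box4.split_mem`), `checkTask_sound` — **if `checkTask (c, i, j, k) = true` then every real quaternion of the top box
`topBox c i j k` and every eleventh ball satisfy `Goal`** (`|q|² > 0` there because the chart coordinate equals `SC`) — and
the covering lemma `exists_topBox_mem`: every real `q` with `q_c = SC` and `|q_k| ≤ SC` lies in some top box of chart `c`.
WHAT THIS IS NOT: the evaluation `checkTask = true` (task files) or `StarPairFar` (final file).
-/

namespace Summit.Ventures.Crystal3D.Theorems.StarFar

open Summit.Ventures.Crystal3D.Theorems.NearIdentity

/-! ### The Y-search -/

/-- **Y-search soundness.** -/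
theorem ySearch_sound (hOK : allCertOK = true) {B : Box4} {w x y z : ℝ} (hx : B.Mem w x y z)
    (hn : 0 < nrm w x y z) :
    ∀ (fuel : ℕ) (Y : Box3) (budget b : ℕ), ySearch (mkCtx B) fuel Y budget = some b →
      ∀ {s0 s1 s2 : ℝ}, Y.Mem s0 s1 s2 → Goal w x y z s0 s1 s2 := by
  intro fuel
  induction fuel with
  | zero =>
    intro Y budget b h s0 s1 s2 hy
    simp only [ySearch] at h
    split_ifs at h with h0 hc
    exact yClosed_sound hOK hc hx hn hy
  | succ fuel ih =>
    intro Y budget b h s0 s1 s2 hy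
    simp only [ySearch] at h
    split_ifs at h with h0 hc he
    · exact yClosed_sound hOK hc hx hn hy
    · split at h
      · exact absurd h (by simp)
      · rename_i b' hb'
        rcases Y.split_mem Y.longAxis he hy with hy' | hy'
        · exact ih _ _ _ h hy'
        · exact ih _ _ _ hb' hy'

/-- **Y-level soundness**: a q-box accepted by the Y-level consists of points satisfying `Goal` for EVERY `Y`
(the root Y-box contains the sphere `|Y|² = 2`). -/
theorem yLevel_sound (hOK : allCertOK = true) {B : Box4} {d : ℕ} (h : yLevel B d = true) {w x y z : ℝ}
    (hx : B.Mem w x y z) (hn : 0 < nrm w x y z) (s0 s1 s2 : ℝ) : Goal w x y z s0 s1 s2 := by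
  intro hs h1 h3 h4
  rw [yLevel, Option.isSome_iff_exists] at h
  obtain ⟨b, hb⟩ := h
  exact ySearch_sound hOK hx hn _ _ _ _ hb (rootY_mem hs) hs h1 h3 h4

/-! ### The q-search -/

/-- **q-search soundness.** -/
theorem qSearch_sound (hOK : allCertOK = true) :
    ∀ (fuel : ℕ) (B : Box4) (d : ℕ), qSearch fuel B d = true →
      ∀ {w x y z : ℝ}, B.Mem w x y z → 0 < nrm w x y z → ∀ s0 s1 s2 : ℝ, Goal w x y z s0 s1 s2 := by
  intro fuel
  induction fuel with
  | zero =>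
    intro B d h w x y z hx hn s0 s1 s2
    rw [qSearch, Bool.or_eq_true, Bool.and_eq_true] at h
    rcases h with h | ⟨-, h⟩
    · exact qBasic_sound hOK h hx hn s0 s1 s2
    · exact yLevel_sound hOK h hx hn s0 s1 s2
  | succ fuel ih =>
    intro B d h w x y z hx hn s0 s1 s2
    rw [qSearch, Bool.or_eq_true, Bool.or_eq_true, Bool.and_eq_true] at h
    rcases h with (h | ⟨-, h⟩) | h
    · exact qBasic_sound hOK h hx hn s0 s1 s2
    · exact yLevel_sound hOK h hx hn s0 s1 s2
    · simp only [Bool.and_eq_true, decide_eq_true_eq] at h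
      obtain ⟨he, h2, h1⟩ := h
      rcases B.split_mem B.longAxis he hx with hx' | hx'
      · exact ih _ _ h1 hx' hn s0 s1 s2
      · exact ih _ _ h2 hx' hn s0 s1 s2

/-! ### The top boxes -/

/-- The chart coordinate of a point of a top box equals `SC`; hence `|q|² > 0`. -/
theorem nrm_pos_of_topBox (c : Fin 4) (i j k : Fin 8) {w x y z : ℝ} (hx : (topBox c i j k).Mem w x y z) :
    0 < nrm w x y z := by
  have hS := SC_spec.1
  obtain ⟨m0, m1, m2, m3⟩ := hx
  fin_cases c
  · simp only [topBox, Int.cast_zero] at m0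
    have : w = SC := by linarith [abs_nonneg (w - SC), abs_eq_zero.1 (le_antisymm m0 (abs_nonneg _))]
    unfold nrm; nlinarith [sq_nonneg x, sq_nonneg y, sq_nonneg z]
  · simp only [topBox, Int.cast_zero] at m1
    have : x = SC := by linarith [abs_eq_zero.1 (le_antisymm m1 (abs_nonneg _))]
    unfold nrm; nlinarith [sq_nonneg w, sq_nonneg y, sq_nonneg z]
  · simp only [topBox, Int.cast_zero] at m2
    have : y = SC := by linarith [abs_eq_zero.1 (le_antisymm m2 (abs_nonneg _))]
    unfold nrm; nlinarith [sq_nonneg w, sq_nonneg x, sq_nonneg z]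
  · simp only [topBox, Int.cast_zero] at m3
    have : z = SC := by linarith [abs_eq_zero.1 (le_antisymm m3 (abs_nonneg _))]
    unfold nrm; nlinarith [sq_nonneg w, sq_nonneg x, sq_nonneg y]

/-- **Task soundness**: if `checkTask (c, i, j, k)` evaluates to `true`, every real quaternion of the top box and every
eleventh ball satisfy `Goal`. -/
theorem checkTask_sound (hOK : allCertOK = true) {c : Fin 4} {i j k : Fin 8}
    (h : checkTask (c, i, j, k) = true) {w x y z : ℝ} (hx : (topBox c i j k).Mem w x y z) (s0 s1 s2 : ℝ) :
    Goal w x y z s0 s1 s2 :=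
  qSearch_sound hOK DQMAX _ 0 h hx (nrm_pos_of_topBox c i j k hx) s0 s1 s2

/-! ### The top boxes of a chart cover the chart -/

/-- `SC / 8` is exact. -/
theorem SC_div_eight : ((SC / 8 : ℤ) : ℝ) = (SC : ℝ) / 8 := by unfold SC; norm_num

/-- Every real `t ∈ [−SC, SC]` lies in one of the eight eighths. -/
theorem exists_eighth {t : ℝ} (ht : |t| ≤ SC) : ∃ i : Fin 8, |t - topC i| ≤ ((SC / 8 : ℤ) : ℝ) := by
  have hS := SC_spec.1
  rcases abs_le.1 ht with ⟨h1, h2⟩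
  set e : ℝ := (SC : ℝ) / 8 with he
  have he0 : 0 < e := by rw [he]; positivity
  set u : ℝ := (t + SC) / (2 * e) with hu
  have hu0 : 0 ≤ u := by rw [hu]; exact div_nonneg (by linarith) (by linarith)
  have hu8 : u ≤ 8 := by
    rw [hu, div_le_iff₀ (by linarith), he]; linarith
  set m := ⌊u⌋₊ with hm
  have hml : (m : ℝ) ≤ u := Nat.floor_le hu0
  have hmu : u < m + 1 := Nat.lt_floor_add_one u
  refine ⟨⟨min m 7, by omega⟩, ?_⟩
  rw [SC_div_eight, topC, abs_le]
  push_cast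
  rw [SC_div_eight, ← he]
  have hte : t = 2 * e * u - SC := by rw [hu]; field_simp; ring
  have hSe : (SC : ℝ) = 8 * e := by rw [he]; ring
  rcases le_or_gt m 7 with h7 | h7
  · have h7' : (m : ℝ) ≤ 7 := by exact_mod_cast h7
    rw [min_eq_left h7']
    constructor <;> nlinarith
  · have h8 : (8 : ℝ) ≤ m := by exact_mod_cast h7
    rw [min_eq_right (by linarith : (7 : ℝ) ≤ m)]
    constructor <;> nlinarith

/-- **Covering**: a real quaternion with chart coordinate `SC` and all coordinates in `[−SC, SC]` lies in some top box. -/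
theorem exists_topBox_mem (c : Fin 4) {q : Fin 4 → ℝ} (hc : q c = SC) (hq : ∀ k, |q k| ≤ SC) :
    ∃ i j k : Fin 8, (topBox c i j k).Mem (q 0) (q 1) (q 2) (q 3) := by
  have hz : ∀ t : ℝ, t = SC → |t - ((SC : ℤ) : ℝ)| ≤ ((0 : ℤ) : ℝ) := by
    intro t ht; rw [ht]; simp
  fin_cases c
  · obtain ⟨i, hi⟩ := exists_eighth (hq 1)
    obtain ⟨j, hj⟩ := exists_eighth (hq 2)
    obtain ⟨k, hk⟩ := exists_eighth (hq 3)
    exact ⟨i, j, k, hz _ hc, hi, hj, hk⟩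
  · obtain ⟨i, hi⟩ := exists_eighth (hq 0)
    obtain ⟨j, hj⟩ := exists_eighth (hq 2)
    obtain ⟨k, hk⟩ := exists_eighth (hq 3)
    exact ⟨i, j, k, hi, hz _ hc, hj, hk⟩
  · obtain ⟨i, hi⟩ := exists_eighth (hq 0)
    obtain ⟨j, hj⟩ := exists_eighth (hq 1)
    obtain ⟨k, hk⟩ := exists_eighth (hq 3)
    exact ⟨i, j, k, hi, hj, hz _ hc, hk⟩
  · obtain ⟨i, hi⟩ := exists_eighth (hq 0)
    obtain ⟨j, hj⟩ := exists_eighth (hq 1)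
    obtain ⟨k, hk⟩ := exists_eighth (hq 2)
    exact ⟨i, j, k, hi, hj, hk, hz _ hc⟩

end Summit.Ventures.Crystal3D.Theorems.StarFar
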